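/-
Copyright (c) 2026. All rights reserved.
Released under Apache 2.0 license as described in the file LICENSE.
-/
import Summits.AtomisticToContinuum.Crystallization.Theorems.OverbindingBudgetAffineFarStraighteningCompatCert

/-!
# Overbinding budget — R_aff′ brick TWOSTEP, integer certificate: snapped readings are complete below `√(8/3)`

Slot Z of `stmt-AtomisticToContinuum-31280`, leaf `…FarSmoothSplit.AffineChartStraightening'` (R_aff′), radial development (g59
memo §3, assembly step (e) EXHAUSTIVENESS).  For an isometric full snap `U` of adjacent framed sites (`U f = −e`, common shell to
common shell) every read point `u'` of the second site with `‖u' − f‖² < 8/3` (i.e. `‖e + U u'‖ < √(8/3)`: the cluster distance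
spectrum from a first-shell point is `{0, 1, 2, 8/3, 3, …}` in squares) reads as a point of the first site: `e + U u' ∈ insert 0 P`.
So the union of two compatible readings creates no new points within `√(8/3)` of a site — the finite fact behind the exhaustiveness
clause `dist (z k) (z j) ≤ 3/2·a₀ → …` of R_aff′ (margin `1.5/(1 − (√6/2)θ) = 1.5774 < √(8/3) = 1.633` at `θ = 1/25`).
This file is the kernel-decided half (one `decide +kernel` per label, 48; exact cross-check `g59/compat/twostep_cert.py`: 1368 full
snaps, 13680 `u'`-cases, 0 failures); the witness `u` is given with its frame decomposition (`SnapDecompOK`) and the pulled-back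
identity `z(u) = 8N u'` (`snapZ` of COMPAT), so the real transport `…StraighteningTwoStep` is the COMPAT transport with a zero test.
-/

namespace Summit.AtomisticToContinuum.Crystallization.Theorems.OverbindingBudgetAffineFarSmoothSplit

open Literature.Geometry.DiscreteGeometry (sqNormInt fccInt hcpInt fccSecondShellInt hcpSecondShellInt)

/-! ## §1  Definitions -/

/-- TWOSTEP core for a label `f` and a chosen independent adjacent pair `c₁, c₂`: for every full snap `(e, d₁, d₂)` and every read
point `u'` of the second site with `3‖u' − f‖² < 8N'`, some read point `u` of the first site decomposes in the frame and pulls back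
to `u'` exactly (`z(u) = 8N u'`). [this file] -/
def SnapTwoStepCore (S S₂ : Finset (Fin 3 → ℤ)) (N : ℤ) (S' S₂' : Finset (Fin 3 → ℤ)) (N' : ℤ) (f c₁ c₂ : Fin 3 → ℤ) : Prop :=
  ∀ e ∈ S, ∀ d₁ ∈ S, ∀ d₂ ∈ S, sqNormInt (d₁ - e) = N → sqNormInt (d₂ - e) = N → N' * dotInt d₁ d₂ = N * dotInt c₁ c₂ →
    (∀ c' ∈ S', sqNormInt (c' - f) = N' →
      ∃ d ∈ S, sqNormInt (d - e) = N ∧ N' * dotInt d d₁ = N * dotInt c' c₁ ∧ N' * dotInt d d₂ = N * dotInt c' c₂) →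
      ∀ u' ∈ insert (0 : Fin 3 → ℤ) (S' ∪ S₂'), 3 * sqNormInt (u' - f) < 8 * N' →
        ∃ u ∈ insert (0 : Fin 3 → ℤ) (S ∪ S₂), SnapDecompOK N e d₁ d₂ u ∧ ∀ i : Fin 3, snapZ N e d₁ d₂ u f c₁ c₂ i = 8 * N * u' i

/-- TWOSTEP certificate at a label `f`. [this file] -/
def SnapTwoStepAt (S S₂ : Finset (Fin 3 → ℤ)) (N : ℤ) (S' S₂' : Finset (Fin 3 → ℤ)) (N' : ℤ) (f : Fin 3 → ℤ) : Prop :=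
  ∃ c₁ ∈ S', ∃ c₂ ∈ S', sqNormInt (c₁ - f) = N' ∧ sqNormInt (c₂ - f) = N' ∧ (2 * dotInt c₁ c₂ = N' ∨ dotInt c₁ c₂ = 0) ∧
    SnapTwoStepCore S S₂ N S' S₂' N' f c₁ c₂

/-! ## §2  The 48 certificates (PROVED, kernel `decide`) -/

/-- TWOSTEP certificate `fcc ← fcc`, label `f = ![1, 1, 0]`. [this file] -/
theorem snapTwoStepAt_fcc_fcc_0 : SnapTwoStepAt fccInt fccSecondShellInt 2 fccInt fccSecondShellInt 2 ![1, 1, 0] := by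
  unfold SnapTwoStepAt SnapTwoStepCore SnapDecompOK snapZ snapK snapA0 snapA1 snapSigma dotInt
  decide +kernel

/-- TWOSTEP certificate `fcc ← fcc`, label `f = ![1, -1, 0]`. [this file] -/
theorem snapTwoStepAt_fcc_fcc_1 : SnapTwoStepAt fccInt fccSecondShellInt 2 fccInt fccSecondShellInt 2 ![1, -1, 0] := by
  unfold SnapTwoStepAt SnapTwoStepCore SnapDecompOK snapZ snapK snapA0 snapA1 snapSigma dotInt
  decide +kernel

/-- TWOSTEP certificate `fcc ← fcc`, label `f = ![-1, 1, 0]`. [this file] -/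
theorem snapTwoStepAt_fcc_fcc_2 : SnapTwoStepAt fccInt fccSecondShellInt 2 fccInt fccSecondShellInt 2 ![-1, 1, 0] := by
  unfold SnapTwoStepAt SnapTwoStepCore SnapDecompOK snapZ snapK snapA0 snapA1 snapSigma dotInt
  decide +kernel

/-- TWOSTEP certificate `fcc ← fcc`, label `f = ![-1, -1, 0]`. [this file] -/
theorem snapTwoStepAt_fcc_fcc_3 : SnapTwoStepAt fccInt fccSecondShellInt 2 fccInt fccSecondShellInt 2 ![-1, -1, 0] := by
  unfold SnapTwoStepAt SnapTwoStepCore SnapDecompOK snapZ snapK snapA0 snapA1 snapSigma dotInt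
  decide +kernel

/-- TWOSTEP certificate `fcc ← fcc`, label `f = ![1, 0, 1]`. [this file] -/
theorem snapTwoStepAt_fcc_fcc_4 : SnapTwoStepAt fccInt fccSecondShellInt 2 fccInt fccSecondShellInt 2 ![1, 0, 1] := by
  unfold SnapTwoStepAt SnapTwoStepCore SnapDecompOK snapZ snapK snapA0 snapA1 snapSigma dotInt
  decide +kernel

/-- TWOSTEP certificate `fcc ← fcc`, label `f = ![1, 0, -1]`. [this file] -/
theorem snapTwoStepAt_fcc_fcc_5 : SnapTwoStepAt fccInt fccSecondShellInt 2 fccInt fccSecondShellInt 2 ![1, 0, -1] := by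
  unfold SnapTwoStepAt SnapTwoStepCore SnapDecompOK snapZ snapK snapA0 snapA1 snapSigma dotInt
  decide +kernel

/-- TWOSTEP certificate `fcc ← fcc`, label `f = ![-1, 0, 1]`. [this file] -/
theorem snapTwoStepAt_fcc_fcc_6 : SnapTwoStepAt fccInt fccSecondShellInt 2 fccInt fccSecondShellInt 2 ![-1, 0, 1] := by
  unfold SnapTwoStepAt SnapTwoStepCore SnapDecompOK snapZ snapK snapA0 snapA1 snapSigma dotInt
  decide +kernel

/-- TWOSTEP certificate `fcc ← fcc`, label `f = ![-1, 0, -1]`. [this file] -/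
theorem snapTwoStepAt_fcc_fcc_7 : SnapTwoStepAt fccInt fccSecondShellInt 2 fccInt fccSecondShellInt 2 ![-1, 0, -1] := by
  unfold SnapTwoStepAt SnapTwoStepCore SnapDecompOK snapZ snapK snapA0 snapA1 snapSigma dotInt
  decide +kernel

/-- TWOSTEP certificate `fcc ← fcc`, label `f = ![0, 1, 1]`. [this file] -/
theorem snapTwoStepAt_fcc_fcc_8 : SnapTwoStepAt fccInt fccSecondShellInt 2 fccInt fccSecondShellInt 2 ![0, 1, 1] := by
  unfold SnapTwoStepAt SnapTwoStepCore SnapDecompOK snapZ snapK snapA0 snapA1 snapSigma dotInt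
  decide +kernel

/-- TWOSTEP certificate `fcc ← fcc`, label `f = ![0, 1, -1]`. [this file] -/
theorem snapTwoStepAt_fcc_fcc_9 : SnapTwoStepAt fccInt fccSecondShellInt 2 fccInt fccSecondShellInt 2 ![0, 1, -1] := by
  unfold SnapTwoStepAt SnapTwoStepCore SnapDecompOK snapZ snapK snapA0 snapA1 snapSigma dotInt
  decide +kernel

/-- TWOSTEP certificate `fcc ← fcc`, label `f = ![0, -1, 1]`. [this file] -/
theorem snapTwoStepAt_fcc_fcc_10 : SnapTwoStepAt fccInt fccSecondShellInt 2 fccInt fccSecondShellInt 2 ![0, -1, 1] := by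
  unfold SnapTwoStepAt SnapTwoStepCore SnapDecompOK snapZ snapK snapA0 snapA1 snapSigma dotInt
  decide +kernel

/-- TWOSTEP certificate `fcc ← fcc`, label `f = ![0, -1, -1]`. [this file] -/
theorem snapTwoStepAt_fcc_fcc_11 : SnapTwoStepAt fccInt fccSecondShellInt 2 fccInt fccSecondShellInt 2 ![0, -1, -1] := by
  unfold SnapTwoStepAt SnapTwoStepCore SnapDecompOK snapZ snapK snapA0 snapA1 snapSigma dotInt
  decide +kernel

/-- TWOSTEP certificate `fcc ← fcc` (all labels). [this file] -/
theorem snapTwoStepAt_fcc_fcc : ∀ f ∈ fccInt, SnapTwoStepAt fccInt fccSecondShellInt 2 fccInt fccSecondShellInt 2 f := by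
  intro f hf
  simp only [fccInt, Finset.mem_insert, Finset.mem_singleton] at hf
  rcases hf with rfl | rfl | rfl | rfl | rfl | rfl | rfl | rfl | rfl | rfl | rfl | rfl
  exacts [snapTwoStepAt_fcc_fcc_0, snapTwoStepAt_fcc_fcc_1, snapTwoStepAt_fcc_fcc_2, snapTwoStepAt_fcc_fcc_3,
    snapTwoStepAt_fcc_fcc_4, snapTwoStepAt_fcc_fcc_5, snapTwoStepAt_fcc_fcc_6, snapTwoStepAt_fcc_fcc_7,
    snapTwoStepAt_fcc_fcc_8, snapTwoStepAt_fcc_fcc_9, snapTwoStepAt_fcc_fcc_10, snapTwoStepAt_fcc_fcc_11]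

/-- TWOSTEP certificate `fcc ← hcp`, label `f = ![3, -3, 0]`. [this file] -/
theorem snapTwoStepAt_fcc_hcp_0 : SnapTwoStepAt fccInt fccSecondShellInt 2 hcpInt hcpSecondShellInt 18 ![3, -3, 0] := by
  unfold SnapTwoStepAt SnapTwoStepCore SnapDecompOK snapZ snapK snapA0 snapA1 snapSigma dotInt
  decide +kernel

/-- TWOSTEP certificate `fcc ← hcp`, label `f = ![-3, 3, 0]`. [this file] -/
theorem snapTwoStepAt_fcc_hcp_1 : SnapTwoStepAt fccInt fccSecondShellInt 2 hcpInt hcpSecondShellInt 18 ![-3, 3, 0] := by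
  unfold SnapTwoStepAt SnapTwoStepCore SnapDecompOK snapZ snapK snapA0 snapA1 snapSigma dotInt
  decide +kernel

/-- TWOSTEP certificate `fcc ← hcp`, label `f = ![3, 0, -3]`. [this file] -/
theorem snapTwoStepAt_fcc_hcp_2 : SnapTwoStepAt fccInt fccSecondShellInt 2 hcpInt hcpSecondShellInt 18 ![3, 0, -3] := by
  unfold SnapTwoStepAt SnapTwoStepCore SnapDecompOK snapZ snapK snapA0 snapA1 snapSigma dotInt
  decide +kernel

/-- TWOSTEP certificate `fcc ← hcp`, label `f = ![-3, 0, 3]`. [this file] -/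
theorem snapTwoStepAt_fcc_hcp_3 : SnapTwoStepAt fccInt fccSecondShellInt 2 hcpInt hcpSecondShellInt 18 ![-3, 0, 3] := by
  unfold SnapTwoStepAt SnapTwoStepCore SnapDecompOK snapZ snapK snapA0 snapA1 snapSigma dotInt
  decide +kernel

/-- TWOSTEP certificate `fcc ← hcp`, label `f = ![0, 3, -3]`. [this file] -/
theorem snapTwoStepAt_fcc_hcp_4 : SnapTwoStepAt fccInt fccSecondShellInt 2 hcpInt hcpSecondShellInt 18 ![0, 3, -3] := by
  unfold SnapTwoStepAt SnapTwoStepCore SnapDecompOK snapZ snapK snapA0 snapA1 snapSigma dotInt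
  decide +kernel

/-- TWOSTEP certificate `fcc ← hcp`, label `f = ![0, -3, 3]`. [this file] -/
theorem snapTwoStepAt_fcc_hcp_5 : SnapTwoStepAt fccInt fccSecondShellInt 2 hcpInt hcpSecondShellInt 18 ![0, -3, 3] := by
  unfold SnapTwoStepAt SnapTwoStepCore SnapDecompOK snapZ snapK snapA0 snapA1 snapSigma dotInt
  decide +kernel

/-- TWOSTEP certificate `fcc ← hcp`, label `f = ![3, 3, 0]`. [this file] -/
theorem snapTwoStepAt_fcc_hcp_6 : SnapTwoStepAt fccInt fccSecondShellInt 2 hcpInt hcpSecondShellInt 18 ![3, 3, 0] := by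
  unfold SnapTwoStepAt SnapTwoStepCore SnapDecompOK snapZ snapK snapA0 snapA1 snapSigma dotInt
  decide +kernel

/-- TWOSTEP certificate `fcc ← hcp`, label `f = ![3, 0, 3]`. [this file] -/
theorem snapTwoStepAt_fcc_hcp_7 : SnapTwoStepAt fccInt fccSecondShellInt 2 hcpInt hcpSecondShellInt 18 ![3, 0, 3] := by
  unfold SnapTwoStepAt SnapTwoStepCore SnapDecompOK snapZ snapK snapA0 snapA1 snapSigma dotInt
  decide +kernel

/-- TWOSTEP certificate `fcc ← hcp`, label `f = ![0, 3, 3]`. [this file] -/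
theorem snapTwoStepAt_fcc_hcp_8 : SnapTwoStepAt fccInt fccSecondShellInt 2 hcpInt hcpSecondShellInt 18 ![0, 3, 3] := by
  unfold SnapTwoStepAt SnapTwoStepCore SnapDecompOK snapZ snapK snapA0 snapA1 snapSigma dotInt
  decide +kernel

/-- TWOSTEP certificate `fcc ← hcp`, label `f = ![-1, -1, -4]`. [this file] -/
theorem snapTwoStepAt_fcc_hcp_9 : SnapTwoStepAt fccInt fccSecondShellInt 2 hcpInt hcpSecondShellInt 18 ![-1, -1, -4] := by
  unfold SnapTwoStepAt SnapTwoStepCore SnapDecompOK snapZ snapK snapA0 snapA1 snapSigma dotInt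
  decide +kernel

/-- TWOSTEP certificate `fcc ← hcp`, label `f = ![-1, -4, -1]`. [this file] -/
theorem snapTwoStepAt_fcc_hcp_10 : SnapTwoStepAt fccInt fccSecondShellInt 2 hcpInt hcpSecondShellInt 18 ![-1, -4, -1] := by
  unfold SnapTwoStepAt SnapTwoStepCore SnapDecompOK snapZ snapK snapA0 snapA1 snapSigma dotInt
  decide +kernel

/-- TWOSTEP certificate `fcc ← hcp`, label `f = ![-4, -1, -1]`. [this file] -/
theorem snapTwoStepAt_fcc_hcp_11 : SnapTwoStepAt fccInt fccSecondShellInt 2 hcpInt hcpSecondShellInt 18 ![-4, -1, -1] := by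
  unfold SnapTwoStepAt SnapTwoStepCore SnapDecompOK snapZ snapK snapA0 snapA1 snapSigma dotInt
  decide +kernel

/-- TWOSTEP certificate `fcc ← hcp` (all labels). [this file] -/
theorem snapTwoStepAt_fcc_hcp : ∀ f ∈ hcpInt, SnapTwoStepAt fccInt fccSecondShellInt 2 hcpInt hcpSecondShellInt 18 f := by
  intro f hf
  simp only [hcpInt, Finset.mem_insert, Finset.mem_singleton] at hf
  rcases hf with rfl | rfl | rfl | rfl | rfl | rfl | rfl | rfl | rfl | rfl | rfl | rfl
  exacts [snapTwoStepAt_fcc_hcp_0, snapTwoStepAt_fcc_hcp_1, snapTwoStepAt_fcc_hcp_2, snapTwoStepAt_fcc_hcp_3,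
    snapTwoStepAt_fcc_hcp_4, snapTwoStepAt_fcc_hcp_5, snapTwoStepAt_fcc_hcp_6, snapTwoStepAt_fcc_hcp_7,
    snapTwoStepAt_fcc_hcp_8, snapTwoStepAt_fcc_hcp_9, snapTwoStepAt_fcc_hcp_10, snapTwoStepAt_fcc_hcp_11]

/-- TWOSTEP certificate `hcp ← fcc`, label `f = ![1, 1, 0]`. [this file] -/
theorem snapTwoStepAt_hcp_fcc_0 : SnapTwoStepAt hcpInt hcpSecondShellInt 18 fccInt fccSecondShellInt 2 ![1, 1, 0] := by
  unfold SnapTwoStepAt SnapTwoStepCore SnapDecompOK snapZ snapK snapA0 snapA1 snapSigma dotInt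
  decide +kernel

/-- TWOSTEP certificate `hcp ← fcc`, label `f = ![1, -1, 0]`. [this file] -/
theorem snapTwoStepAt_hcp_fcc_1 : SnapTwoStepAt hcpInt hcpSecondShellInt 18 fccInt fccSecondShellInt 2 ![1, -1, 0] := by
  unfold SnapTwoStepAt SnapTwoStepCore SnapDecompOK snapZ snapK snapA0 snapA1 snapSigma dotInt
  decide +kernel

/-- TWOSTEP certificate `hcp ← fcc`, label `f = ![-1, 1, 0]`. [this file] -/
theorem snapTwoStepAt_hcp_fcc_2 : SnapTwoStepAt hcpInt hcpSecondShellInt 18 fccInt fccSecondShellInt 2 ![-1, 1, 0] := by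
  unfold SnapTwoStepAt SnapTwoStepCore SnapDecompOK snapZ snapK snapA0 snapA1 snapSigma dotInt
  decide +kernel

/-- TWOSTEP certificate `hcp ← fcc`, label `f = ![-1, -1, 0]`. [this file] -/
theorem snapTwoStepAt_hcp_fcc_3 : SnapTwoStepAt hcpInt hcpSecondShellInt 18 fccInt fccSecondShellInt 2 ![-1, -1, 0] := by
  unfold SnapTwoStepAt SnapTwoStepCore SnapDecompOK snapZ snapK snapA0 snapA1 snapSigma dotInt
  decide +kernel

/-- TWOSTEP certificate `hcp ← fcc`, label `f = ![1, 0, 1]`. [this file] -/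
theorem snapTwoStepAt_hcp_fcc_4 : SnapTwoStepAt hcpInt hcpSecondShellInt 18 fccInt fccSecondShellInt 2 ![1, 0, 1] := by
  unfold SnapTwoStepAt SnapTwoStepCore SnapDecompOK snapZ snapK snapA0 snapA1 snapSigma dotInt
  decide +kernel

/-- TWOSTEP certificate `hcp ← fcc`, label `f = ![1, 0, -1]`. [this file] -/
theorem snapTwoStepAt_hcp_fcc_5 : SnapTwoStepAt hcpInt hcpSecondShellInt 18 fccInt fccSecondShellInt 2 ![1, 0, -1] := by
  unfold SnapTwoStepAt SnapTwoStepCore SnapDecompOK snapZ snapK snapA0 snapA1 snapSigma dotInt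
  decide +kernel

/-- TWOSTEP certificate `hcp ← fcc`, label `f = ![-1, 0, 1]`. [this file] -/
theorem snapTwoStepAt_hcp_fcc_6 : SnapTwoStepAt hcpInt hcpSecondShellInt 18 fccInt fccSecondShellInt 2 ![-1, 0, 1] := by
  unfold SnapTwoStepAt SnapTwoStepCore SnapDecompOK snapZ snapK snapA0 snapA1 snapSigma dotInt
  decide +kernel

/-- TWOSTEP certificate `hcp ← fcc`, label `f = ![-1, 0, -1]`. [this file] -/
theorem snapTwoStepAt_hcp_fcc_7 : SnapTwoStepAt hcpInt hcpSecondShellInt 18 fccInt fccSecondShellInt 2 ![-1, 0, -1] := by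
  unfold SnapTwoStepAt SnapTwoStepCore SnapDecompOK snapZ snapK snapA0 snapA1 snapSigma dotInt
  decide +kernel

/-- TWOSTEP certificate `hcp ← fcc`, label `f = ![0, 1, 1]`. [this file] -/
theorem snapTwoStepAt_hcp_fcc_8 : SnapTwoStepAt hcpInt hcpSecondShellInt 18 fccInt fccSecondShellInt 2 ![0, 1, 1] := by
  unfold SnapTwoStepAt SnapTwoStepCore SnapDecompOK snapZ snapK snapA0 snapA1 snapSigma dotInt
  decide +kernel

/-- TWOSTEP certificate `hcp ← fcc`, label `f = ![0, 1, -1]`. [this file] -/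
theorem snapTwoStepAt_hcp_fcc_9 : SnapTwoStepAt hcpInt hcpSecondShellInt 18 fccInt fccSecondShellInt 2 ![0, 1, -1] := by
  unfold SnapTwoStepAt SnapTwoStepCore SnapDecompOK snapZ snapK snapA0 snapA1 snapSigma dotInt
  decide +kernel

/-- TWOSTEP certificate `hcp ← fcc`, label `f = ![0, -1, 1]`. [this file] -/
theorem snapTwoStepAt_hcp_fcc_10 : SnapTwoStepAt hcpInt hcpSecondShellInt 18 fccInt fccSecondShellInt 2 ![0, -1, 1] := by
  unfold SnapTwoStepAt SnapTwoStepCore SnapDecompOK snapZ snapK snapA0 snapA1 snapSigma dotInt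
  decide +kernel

/-- TWOSTEP certificate `hcp ← fcc`, label `f = ![0, -1, -1]`. [this file] -/
theorem snapTwoStepAt_hcp_fcc_11 : SnapTwoStepAt hcpInt hcpSecondShellInt 18 fccInt fccSecondShellInt 2 ![0, -1, -1] := by
  unfold SnapTwoStepAt SnapTwoStepCore SnapDecompOK snapZ snapK snapA0 snapA1 snapSigma dotInt
  decide +kernel

/-- TWOSTEP certificate `hcp ← fcc` (all labels). [this file] -/
theorem snapTwoStepAt_hcp_fcc : ∀ f ∈ fccInt, SnapTwoStepAt hcpInt hcpSecondShellInt 18 fccInt fccSecondShellInt 2 f := by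
  intro f hf
  simp only [fccInt, Finset.mem_insert, Finset.mem_singleton] at hf
  rcases hf with rfl | rfl | rfl | rfl | rfl | rfl | rfl | rfl | rfl | rfl | rfl | rfl
  exacts [snapTwoStepAt_hcp_fcc_0, snapTwoStepAt_hcp_fcc_1, snapTwoStepAt_hcp_fcc_2, snapTwoStepAt_hcp_fcc_3,
    snapTwoStepAt_hcp_fcc_4, snapTwoStepAt_hcp_fcc_5, snapTwoStepAt_hcp_fcc_6, snapTwoStepAt_hcp_fcc_7,
    snapTwoStepAt_hcp_fcc_8, snapTwoStepAt_hcp_fcc_9, snapTwoStepAt_hcp_fcc_10, snapTwoStepAt_hcp_fcc_11]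

/-- TWOSTEP certificate `hcp ← hcp`, label `f = ![3, -3, 0]`. [this file] -/
theorem snapTwoStepAt_hcp_hcp_0 : SnapTwoStepAt hcpInt hcpSecondShellInt 18 hcpInt hcpSecondShellInt 18 ![3, -3, 0] := by
  unfold SnapTwoStepAt SnapTwoStepCore SnapDecompOK snapZ snapK snapA0 snapA1 snapSigma dotInt
  decide +kernel

/-- TWOSTEP certificate `hcp ← hcp`, label `f = ![-3, 3, 0]`. [this file] -/
theorem snapTwoStepAt_hcp_hcp_1 : SnapTwoStepAt hcpInt hcpSecondShellInt 18 hcpInt hcpSecondShellInt 18 ![-3, 3, 0] := by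
  unfold SnapTwoStepAt SnapTwoStepCore SnapDecompOK snapZ snapK snapA0 snapA1 snapSigma dotInt
  decide +kernel

/-- TWOSTEP certificate `hcp ← hcp`, label `f = ![3, 0, -3]`. [this file] -/
theorem snapTwoStepAt_hcp_hcp_2 : SnapTwoStepAt hcpInt hcpSecondShellInt 18 hcpInt hcpSecondShellInt 18 ![3, 0, -3] := by
  unfold SnapTwoStepAt SnapTwoStepCore SnapDecompOK snapZ snapK snapA0 snapA1 snapSigma dotInt
  decide +kernel

/-- TWOSTEP certificate `hcp ← hcp`, label `f = ![-3, 0, 3]`. [this file] -/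
theorem snapTwoStepAt_hcp_hcp_3 : SnapTwoStepAt hcpInt hcpSecondShellInt 18 hcpInt hcpSecondShellInt 18 ![-3, 0, 3] := by
  unfold SnapTwoStepAt SnapTwoStepCore SnapDecompOK snapZ snapK snapA0 snapA1 snapSigma dotInt
  decide +kernel

/-- TWOSTEP certificate `hcp ← hcp`, label `f = ![0, 3, -3]`. [this file] -/
theorem snapTwoStepAt_hcp_hcp_4 : SnapTwoStepAt hcpInt hcpSecondShellInt 18 hcpInt hcpSecondShellInt 18 ![0, 3, -3] := by
  unfold SnapTwoStepAt SnapTwoStepCore SnapDecompOK snapZ snapK snapA0 snapA1 snapSigma dotInt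
  decide +kernel

/-- TWOSTEP certificate `hcp ← hcp`, label `f = ![0, -3, 3]`. [this file] -/
theorem snapTwoStepAt_hcp_hcp_5 : SnapTwoStepAt hcpInt hcpSecondShellInt 18 hcpInt hcpSecondShellInt 18 ![0, -3, 3] := by
  unfold SnapTwoStepAt SnapTwoStepCore SnapDecompOK snapZ snapK snapA0 snapA1 snapSigma dotInt
  decide +kernel

/-- TWOSTEP certificate `hcp ← hcp`, label `f = ![3, 3, 0]`. [this file] -/
theorem snapTwoStepAt_hcp_hcp_6 : SnapTwoStepAt hcpInt hcpSecondShellInt 18 hcpInt hcpSecondShellInt 18 ![3, 3, 0] := by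
  unfold SnapTwoStepAt SnapTwoStepCore SnapDecompOK snapZ snapK snapA0 snapA1 snapSigma dotInt
  decide +kernel

/-- TWOSTEP certificate `hcp ← hcp`, label `f = ![3, 0, 3]`. [this file] -/
theorem snapTwoStepAt_hcp_hcp_7 : SnapTwoStepAt hcpInt hcpSecondShellInt 18 hcpInt hcpSecondShellInt 18 ![3, 0, 3] := by
  unfold SnapTwoStepAt SnapTwoStepCore SnapDecompOK snapZ snapK snapA0 snapA1 snapSigma dotInt
  decide +kernel

/-- TWOSTEP certificate `hcp ← hcp`, label `f = ![0, 3, 3]`. [this file] -/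
theorem snapTwoStepAt_hcp_hcp_8 : SnapTwoStepAt hcpInt hcpSecondShellInt 18 hcpInt hcpSecondShellInt 18 ![0, 3, 3] := by
  unfold SnapTwoStepAt SnapTwoStepCore SnapDecompOK snapZ snapK snapA0 snapA1 snapSigma dotInt
  decide +kernel

/-- TWOSTEP certificate `hcp ← hcp`, label `f = ![-1, -1, -4]`. [this file] -/
theorem snapTwoStepAt_hcp_hcp_9 : SnapTwoStepAt hcpInt hcpSecondShellInt 18 hcpInt hcpSecondShellInt 18 ![-1, -1, -4] := by
  unfold SnapTwoStepAt SnapTwoStepCore SnapDecompOK snapZ snapK snapA0 snapA1 snapSigma dotInt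
  decide +kernel

/-- TWOSTEP certificate `hcp ← hcp`, label `f = ![-1, -4, -1]`. [this file] -/
theorem snapTwoStepAt_hcp_hcp_10 : SnapTwoStepAt hcpInt hcpSecondShellInt 18 hcpInt hcpSecondShellInt 18 ![-1, -4, -1] := by
  unfold SnapTwoStepAt SnapTwoStepCore SnapDecompOK snapZ snapK snapA0 snapA1 snapSigma dotInt
  decide +kernel

/-- TWOSTEP certificate `hcp ← hcp`, label `f = ![-4, -1, -1]`. [this file] -/
theorem snapTwoStepAt_hcp_hcp_11 : SnapTwoStepAt hcpInt hcpSecondShellInt 18 hcpInt hcpSecondShellInt 18 ![-4, -1, -1] := by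
  unfold SnapTwoStepAt SnapTwoStepCore SnapDecompOK snapZ snapK snapA0 snapA1 snapSigma dotInt
  decide +kernel

/-- TWOSTEP certificate `hcp ← hcp` (all labels). [this file] -/
theorem snapTwoStepAt_hcp_hcp : ∀ f ∈ hcpInt, SnapTwoStepAt hcpInt hcpSecondShellInt 18 hcpInt hcpSecondShellInt 18 f := by
  intro f hf
  simp only [hcpInt, Finset.mem_insert, Finset.mem_singleton] at hf
  rcases hf with rfl | rfl | rfl | rfl | rfl | rfl | rfl | rfl | rfl | rfl | rfl | rfl
  exacts [snapTwoStepAt_hcp_hcp_0, snapTwoStepAt_hcp_hcp_1, snapTwoStepAt_hcp_hcp_2, snapTwoStepAt_hcp_hcp_3,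
    snapTwoStepAt_hcp_hcp_4, snapTwoStepAt_hcp_hcp_5, snapTwoStepAt_hcp_hcp_6, snapTwoStepAt_hcp_hcp_7,
    snapTwoStepAt_hcp_hcp_8, snapTwoStepAt_hcp_hcp_9, snapTwoStepAt_hcp_hcp_10, snapTwoStepAt_hcp_hcp_11]

end Summit.AtomisticToContinuum.Crystallization.Theorems.OverbindingBudgetAffineFarSmoothSplit
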